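import Literature.AlgebraicGeometry.Modules.Torsion
import Literature.AlgebraicGeometry.Modules.AffineLocalizingClosure
import Literature.AlgebraicGeometry.Modules.FiniteType
import Literature.AlgebraicGeometry.Modules.SectionsExact
import Literature.AlgebraicGeometry.Modules.QcohLocalization
import Literature.AlgebraicGeometry.Modules.LinearOverBase
import Literature.AlgebraicGeometry.Morphisms.CohAffineExactness
import Literature.AlgebraicGeometry.Motives.ChernClassesProofs
import Mathlib.RingTheory.Ideal.Operations
import HarnessLib

/-!
# The submodule `𝒥M ⊆ M` and the quotient `M/𝒥M` for an ideal sheaf `𝒥`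

The Stacks Project, Tag 01CL (Modules, §17.13–17.15) / Görtz–Wedhorn I, (7.15) p. 186: for a
sheaf of ideals `𝒥 ⊆ 𝒪_X` and an `𝒪_X`-module `M`, `𝒥M ⊆ M` is the image of `𝒥 ⊗ M → M`, i.e. the
subsheaf generated by the products, and `M/𝒥M = M ⊗ 𝒪_X/𝒥` is the largest quotient of `M`
annihilated by `𝒥`; for `M` quasi-coherent on an affine open `V = Spec B` one has
`Γ(V, 𝒥M) = 𝒥(V)·Γ(V, M)` and `Γ(V, M/𝒥M) = Γ(V, M)/𝒥(V)Γ(V, M)` (Görtz–Wedhorn I Prop. 7.14 /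
Hartshorne II Prop. 5.6: `~` is exact and commutes with these operations).

For an ideal sheaf given by its affine data `J : X.IdealSheafData` (Mathlib) this file constructs,
without tensor products (the tree's `Modules/TensorProduct` has no sections formula):

* `IsIdealMulSection M J U m` — `m ∈ Γ(U, M)` is LOCALLY a sum of products: every point of `U`
  has an affine neighbourhood `V ⊆ U` with `m|_V ∈ 𝒥(V)·Γ(V, M)`; these form a subsheaf of modules
  `idealMul M J = 𝒥M ⊆ M` (`idealMulι`, a monomorphism; pattern of `Modules/Torsion`);
* `isIdealMulSection_iff_of_isAffineOpen` — **for `M` affine-localizing and `U` affine,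
  `m ∈ Γ(U, 𝒥M) ↔ m ∈ 𝒥(U)·Γ(U, M)`** (partition of unity on `U`: Mathlib
  `Submodule.mem_of_span_eq_top_of_smul_pow_mem`, numerators and torsion of `M`);
* `isAffineLocalizing_idealMul`, `coh_idealMul` — `𝒥M` is affine-localizing, and coherent if `M` is
  (`X` locally noetherian);
* `idealQuot M J = M/𝒥M := coker(𝒥M → M)` with `idealQuotπ` (epi), `coh_idealQuot`,
  `idealQuotπ_app_surjective`, **`idealQuotπ_app_eq_zero_iff`** (`Γ(V, M/𝒥M) = Γ(V,M)/𝒥(V)Γ(V,M)` on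
  affine `V`), `isKilledBy_idealQuot` (`𝒥·(M/𝒥M) = 0`), `isIso_idealQuotπ_of_isKilledBy`;
* the universal property `idealQuotDesc` (a morphism to a module killed by `𝒥` factors uniquely
  through `M/𝒥M`; `idealMulι_comp_eq_zero`), the functor `idealQuotFunctor J : M ↦ M/𝒥M` with the
  natural epimorphism `idealQuotπ` (`idealQuotMap`), preservation of epimorphisms, `idealQuotMap_globalScalar`,
  and **right exactness**: `idealQuotCokernelIso : coker(w/𝒥) ≅ (coker w)/𝒥`.

Everything is proved; no named facts. Mathlib searched (pin v4.32): `PresheafOfModules.Submodule`,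
`Scheme.IdealSheafData` (`map_ideal_basicOpen`, `ideal_le_comap_ideal`),
`IsAffineOpen.self_le_iSup_basicOpen_iff`, `Submodule.mem_of_span_eq_top_of_smul_pow_mem`,
`Submodule.smul_induction_on` (used); Mathlib has no `𝒥M` / `M/𝒥M` for sheaves of modules.

## References

* The Stacks Project, Tag 01CL (Modules, closed immersions and ideals), Tag 01CA. [StacksProject]
* U. Görtz, T. Wedhorn, *Algebraic Geometry I: Schemes*, 2nd ed. (2020), (7.15) and Prop. 7.14
  (p. 186). [GortzWedhorn2020]
* R. Hartshorne, *Algebraic Geometry*, GTM 52 (1977), II Prop. 5.6 (p. 113). [Hartshorne1977]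
-/

noncomputable section

-- `TopCat.Presheaf`/`Scheme.Modules` are not reducible (as in Mathlib's `AlgebraicGeometry/Modules`).
set_option backward.isDefEq.respectTransparency false

open CategoryTheory AlgebraicGeometry Limits TopologicalSpace Opposite

universe u

namespace Literature.AlgebraicGeometry.Modules

open Literature.AlgebraicGeometry.Motives Literature.AlgebraicGeometry.Morphisms

variable {X : Scheme.{u}} (M : X.Modules) (J : X.IdealSheafData)

/-! ## Restriction maps and the submodules `𝒥(V)·Γ(V, M)` -/

variable {M J} in
/-- Restriction along affine opens `V' ⊆ V` maps `𝒥(V)·Γ(V, M)` into `𝒥(V')·Γ(V', M)`. [folklore] -/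
theorem map_mem_ideal_smul_top {V V' : X.affineOpens} (h : (V' : X.Opens) ≤ V) {m : Γ(M, V)}
    (hm : m ∈ J.ideal V • (⊤ : Submodule Γ(X, V) Γ(M, V))) :
    M.presheaf.map (homOfLE h).op m ∈ J.ideal V' • (⊤ : Submodule Γ(X, V') Γ(M, V')) := by
  refine Submodule.smul_induction_on hm (fun r hr n _ => ?_) (fun x y hx hy => ?_)
  · rw [Scheme.Modules.map_smul]
    exact Submodule.smul_mem_smul (J.ideal_le_comap_ideal h hr) trivial
  · rw [map_add]
    exact Submodule.add_mem _ hx hy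

variable {M J} in
/-- A morphism of modules maps `𝒥(V)·Γ(V, M)` into `𝒥(V)·Γ(V, N)`. [folklore] -/
theorem app_mem_ideal_smul_top {N : X.Modules} (φ : M ⟶ N) (V : X.affineOpens) {m : Γ(M, V)}
    (hm : m ∈ J.ideal V • (⊤ : Submodule Γ(X, V) Γ(M, V))) :
    φ.app V m ∈ J.ideal V • (⊤ : Submodule Γ(X, V) Γ(N, V)) := by
  refine Submodule.smul_induction_on hm (fun r hr n _ => ?_) (fun x y hx hy => ?_)
  · rw [Scheme.Modules.Hom.app_smul]
    exact Submodule.smul_mem_smul hr trivial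
  · rw [map_add]
    exact Submodule.add_mem _ hx hy

variable {M J} in
/-- If `𝒥` kills `N` then `𝒥(V)·Γ(V, N) = 0`. [folklore] -/
theorem ideal_smul_top_eq_bot_of_isKilledBy {N : X.Modules} (hN : IsKilledBy J N) (V : X.affineOpens) :
    J.ideal V • (⊤ : Submodule Γ(X, V) Γ(N, V)) = ⊥ := by
  rw [eq_bot_iff]
  intro x hx
  refine Submodule.smul_induction_on hx (fun r hr n _ => ?_) (fun x y hx hy => ?_)
  · exact hN V r hr n
  · rw [Submodule.mem_bot] at hx hy
    rw [hx, hy, add_zero]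
    exact Submodule.zero_mem _

/-- A section of a module vanishing locally vanishes. [folklore] -/
theorem section_eq_zero_of_locally (N : X.Modules) {U : X.Opens} (t : Γ(N, U))
    (h : ∀ x ∈ U, ∃ (V : X.Opens) (hV : V ≤ U), x ∈ V ∧ N.presheaf.map (homOfLE hV).op t = 0) :
    t = 0 := by
  choose V hV hxV htV using h
  refine TopCat.Sheaf.eq_of_locally_eq' (abSheafOf N) (fun p : {x // x ∈ U} => V p.1 p.2) U
    (fun p => homOfLE (hV p.1 p.2)) (fun x hx => Opens.mem_iSup.mpr ⟨⟨x, hx⟩, hxV x hx⟩) t 0 fun p => ?_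
  change N.presheaf.map (homOfLE (hV p.1 p.2)).op t = N.presheaf.map (homOfLE (hV p.1 p.2)).op 0
  rw [map_zero]
  exact htV p.1 p.2

variable {J} in
/-- **A quotient of a module killed by `𝒥` is killed by `𝒥`** (epimorphisms are locally surjective).
[folklore] -/
theorem IsKilledBy.of_epi {A B : X.Modules} (e : A ⟶ B) [Epi e] (hA : IsKilledBy J A) :
    IsKilledBy J B := by
  intro V r hr b
  refine section_eq_zero_of_locally B _ fun x hx => ?_
  obtain ⟨W, hWV, hxW, a, ha⟩ := Scheme.Modules.exists_app_eq_of_epi e V b x hx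
  obtain ⟨W', hW', hxW', hW'le⟩ := Opens.isBasis_iff_nbhd.mp X.isBasis_affineOpens hxW
  refine ⟨W', hW'le.trans hWV, hxW', ?_⟩
  have hle : (⟨W', hW'⟩ : X.affineOpens) ≤ V := hW'le.trans hWV
  rw [Scheme.Modules.map_smul, map_eq_map B _ ((homOfLE hWV).op ≫ (homOfLE hW'le).op),
    ← map_map, ← ha, ← Scheme.Modules.Hom.app_map_apply, ← Scheme.Modules.Hom.app_smul]
  exact (congrArg (e.app W') (hA ⟨W', hW'⟩ _ (J.ideal_le_comap_ideal hle hr) _)).trans (map_zero _)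

/-! ## Product sections and the subsheaf `𝒥M` -/

/-- A section `m ∈ Γ(U, M)` is a **`𝒥`-product section** if every point of `U` has an affine
neighbourhood `V ⊆ U` with `m|_V ∈ 𝒥(V)·Γ(V, M)`. [folklore] -/
def IsIdealMulSection (U : X.Opens) (m : Γ(M, U)) : Prop :=
  ∀ x ∈ U, ∃ (V : X.affineOpens) (hV : (V : X.Opens) ≤ U), x ∈ (V : X.Opens) ∧
    M.presheaf.map (homOfLE hV).op m ∈ J.ideal V • (⊤ : Submodule Γ(X, V) Γ(M, V))

variable {M J} in
/-- Product sections restrict to product sections. [folklore] -/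
theorem IsIdealMulSection.map {U W : X.Opens} {m : Γ(M, U)} (hm : IsIdealMulSection M J U m)
    (h : W ≤ U) : IsIdealMulSection M J W (M.presheaf.map (homOfLE h).op m) := by
  intro x hx
  obtain ⟨V, hV, hxV, hmem⟩ := hm x (h hx)
  obtain ⟨V', hV', hxV', hV'le⟩ :=
    Opens.isBasis_iff_nbhd.mp X.isBasis_affineOpens (show x ∈ (V : X.Opens) ⊓ W from ⟨hxV, hx⟩)
  refine ⟨⟨V', hV'⟩, hV'le.trans inf_le_right, hxV', ?_⟩
  have hle : (⟨V', hV'⟩ : X.affineOpens) ≤ V := hV'le.trans inf_le_left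
  rw [map_map, map_eq_map M _ ((homOfLE hV).op ≫ (homOfLE (hV'le.trans inf_le_left)).op), ← map_map]
  exact map_mem_ideal_smul_top hle hmem

variable {M J} in
/-- On an affine `U`, an element of `𝒥(U)·Γ(U, M)` is a product section. [folklore] -/
theorem isIdealMulSection_of_mem {U : X.Opens} (hU : IsAffineOpen U) {m : Γ(M, U)}
    (hm : m ∈ J.ideal ⟨U, hU⟩ • (⊤ : Submodule Γ(X, U) Γ(M, U))) : IsIdealMulSection M J U m :=
  fun x hx => ⟨⟨U, hU⟩, le_rfl, hx, by rwa [map_self]⟩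

/-- The product sections over `U` form a submodule of `Γ(U, M)`. [folklore] -/
def idealMulSubmoduleObj (U : X.Opens) : Submodule Γ(X, U) Γ(M, U) where
  carrier := {m | IsIdealMulSection M J U m}
  zero_mem' := fun x hx => by
    obtain ⟨V, hV, hxV, hVU⟩ := Opens.isBasis_iff_nbhd.mp X.isBasis_affineOpens hx
    exact ⟨⟨V, hV⟩, hVU, hxV, by rw [map_zero]; exact Submodule.zero_mem _⟩
  add_mem' := fun {a b} ha hb x hx => by
    obtain ⟨V, hV, hxV, hma⟩ := ha x hx
    obtain ⟨W, hW, hxW, hmb⟩ := (IsIdealMulSection.map hb hV) x hxV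
    refine ⟨W, hW.trans hV, hxW, ?_⟩
    rw [map_add, map_eq_map M _ ((homOfLE hV).op ≫ (homOfLE hW).op) a,
      map_eq_map M _ ((homOfLE hV).op ≫ (homOfLE hW).op) b, ← map_map, ← map_map]
    exact Submodule.add_mem _ (map_mem_ideal_smul_top (show W ≤ V from hW) hma) hmb
  smul_mem' := fun t m hm x hx => by
    obtain ⟨V, hV, hxV, hmem⟩ := hm x hx
    refine ⟨V, hV, hxV, ?_⟩
    rw [Scheme.Modules.map_smul]
    exact Submodule.smul_mem _ _ hmem

/-- Membership in `idealMulSubmoduleObj`. [folklore] -/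
theorem mem_idealMulSubmoduleObj_iff {U : X.Opens} (m : Γ(M, U)) :
    m ∈ idealMulSubmoduleObj M J U ↔ IsIdealMulSection M J U m := Iff.rfl

/-- The family `U ↦ 𝒥M(U)` is stable under restriction. [folklore] -/
def idealMulSubmodule : PresheafOfModules.Submodule M.val where
  obj U := idealMulSubmoduleObj M J U.unop
  map {U W} f := fun m hm => by
    change IsIdealMulSection M J W.unop (M.presheaf.map f m)
    have e : f = (homOfLE f.unop.le).op := Subsingleton.elim _ _
    rw [e]
    exact IsIdealMulSection.map hm f.unop.le

/-- **`𝒥M` is a sheaf** (the condition is local by definition). [folklore] -/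
theorem isSheaf_idealMul :
    TopCat.Presheaf.IsSheaf (idealMulSubmodule M J).toPresheafOfModules.presheaf := by
  rw [TopCat.Presheaf.isSheaf_iff_isSheafUniqueGluing]
  intro ι U sf hsf
  have hsf' : TopCat.Presheaf.IsCompatible M.presheaf U fun i => (sf i).val := fun i j =>
    congrArg Subtype.val (hsf i j)
  obtain ⟨s, hs, huniq⟩ := M.isSheaf.isSheafUniqueGluing U (fun i => (sf i).val) hsf'
  have hsprod : IsIdealMulSection M J (iSup U) s := by
    intro x hx
    obtain ⟨i, hi⟩ := Opens.mem_iSup.mp hx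
    obtain ⟨V, hV, hxV, hmem⟩ := (sf i).2 x hi
    refine ⟨V, hV.trans (le_iSup U i), hxV, ?_⟩
    have e : (homOfLE (hV.trans (le_iSup U i))).op = (Opens.leSupr U i).op ≫ (homOfLE hV).op :=
      Subsingleton.elim _ _
    rw [e, ← map_map, hs i]
    exact hmem
  refine ⟨⟨s, hsprod⟩, fun i => Subtype.ext (hs i), fun t ht => Subtype.ext (huniq t.val fun i => ?_)⟩
  exact congrArg Subtype.val (ht i)

/-- **The subsheaf `𝒥M ⊆ M`.** [cite: StacksProject, Tag 01CL] -/
def idealMul : X.Modules := ⟨(idealMulSubmodule M J).toPresheafOfModules, isSheaf_idealMul M J⟩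

/-- The inclusion `𝒥M ⟶ M`. [folklore] -/
def idealMulι : idealMul M J ⟶ M := ⟨(idealMulSubmodule M J).ι⟩

/-- Sections of `𝒥M` are product sections (definitionally). [folklore] -/
theorem idealMulι_app_apply (U : X.Opens) (m : Γ(idealMul M J, U)) :
    (idealMulι M J).app U m = (m : idealMulSubmoduleObj M J U).val := rfl

/-- A section of `𝒥M` is a product section of `M`. [folklore] -/
theorem isIdealMulSection_idealMulι_app (U : X.Opens) (m : Γ(idealMul M J, U)) :
    IsIdealMulSection M J U ((idealMulι M J).app U m) := (m : idealMulSubmoduleObj M J U).2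

/-- `idealMulι` is injective on sections. [folklore] -/
theorem idealMulι_app_injective (U : X.Opens) : Function.Injective ((idealMulι M J).app U) :=
  fun _ _ h => Subtype.ext h

/-- A product section of `M` over `U` is a section of `𝒥M`. [folklore] -/
theorem exists_idealMulι_app_eq {U : X.Opens} (m : Γ(M, U)) (hm : IsIdealMulSection M J U m) :
    ∃ m' : Γ(idealMul M J, U), (idealMulι M J).app U m' = m := ⟨⟨m, hm⟩, rfl⟩

/-- `𝒥M ⟶ M` is a monomorphism. [folklore] -/
instance mono_idealMulι : Mono (idealMulι M J) :=
  (Scheme.Modules.toPresheafOfModules X).mono_of_mono_map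
    (inferInstanceAs (Mono (idealMulSubmodule M J).ι))

/-! ## The affine description `Γ(U, 𝒥M) = 𝒥(U)·Γ(U, M)` -/

section Affine

variable {M J} (hM : IsAffineLocalizing M) {V : X.Opens} (hV : IsAffineOpen V)

include hM in
/-- **Clearing denominators**: a section `s` of `M` over `D = D(g) ⊆ V` lying in `𝒥(D)·Γ(D, M)`
satisfies `g^N|_D • s = y|_D` for some `y ∈ 𝒥(V)·Γ(V, M)` (`𝒥(D(g)) = 𝒥(V)·Γ(D(g), 𝒪)`, Mathlib
`IdealSheafData.map_ideal`, and the numerators of `M`). [folklore] -/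
theorem exists_pow_smul_eq_map_of_mem (g : Γ(X, V)) {D : X.affineOpens}
    (hD : (D : X.Opens) = X.basicOpen g) (s : Γ(M, D))
    (hs : s ∈ J.ideal D • (⊤ : Submodule Γ(X, D) Γ(M, D))) :
    ∃ (N : ℕ) (y : Γ(M, V)), y ∈ J.ideal ⟨V, hV⟩ • (⊤ : Submodule Γ(X, V) Γ(M, V)) ∧
      M.presheaf.map (homOfLE (hD.trans_le (X.basicOpen_le g))).op y =
        X.presheaf.map (homOfLE (hD.trans_le (X.basicOpen_le g))).op g ^ N • s := by
  have hDV : D ≤ ⟨V, hV⟩ := hD.trans_le (X.basicOpen_le g)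
  -- the predicate to be proved by induction over `𝒥(D)·Γ(D, M)`
  let p : Γ(M, D) → Prop := fun u => ∃ (N : ℕ) (y : Γ(M, V)),
    y ∈ J.ideal ⟨V, hV⟩ • (⊤ : Submodule Γ(X, V) Γ(M, V)) ∧
      M.presheaf.map (homOfLE (hD.trans_le (X.basicOpen_le g))).op y =
        X.presheaf.map (homOfLE (hD.trans_le (X.basicOpen_le g))).op g ^ N • u
  have hadd : ∀ u v, p u → p v → p (u + v) := by
    rintro u v ⟨N₁, y₁, hy₁, h₁⟩ ⟨N₂, y₂, hy₂, h₂⟩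
    refine ⟨N₁ + N₂, g ^ N₂ • y₁ + g ^ N₁ • y₂,
      Submodule.add_mem _ (Submodule.smul_mem _ _ hy₁) (Submodule.smul_mem _ _ hy₂), ?_⟩
    rw [map_add, Scheme.Modules.map_smul, Scheme.Modules.map_smul, h₁, h₂, map_pow, map_pow,
      smul_smul, smul_smul, ← pow_add, ← pow_add, add_comm N₂ N₁, smul_add]
  change p s
  refine Submodule.smul_induction_on (p := p) hs (fun r hr n _ => ?_) hadd
  -- `r ∈ 𝒥(D) = 𝒥(V)·Γ(D, 𝒪)`: induct over the span
  rw [← J.map_ideal hDV] at hr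
  change r ∈ Submodule.span _ _ at hr
  induction hr using Submodule.span_induction generalizing n with
  | mem r hr =>
    obtain ⟨j, hj, rfl⟩ := hr
    obtain ⟨k, x, hx⟩ := hM.numerator hV g hD n
    refine ⟨k, j • x, Submodule.smul_mem_smul hj trivial, ?_⟩
    rw [Scheme.Modules.map_smul, hx, smul_smul, smul_smul, mul_comm]
    rfl
  | zero => exact ⟨0, 0, Submodule.zero_mem _, by rw [map_zero, zero_smul, smul_zero]⟩
  | add r₁ r₂ _ _ h₁ h₂ => rw [add_smul]; exact hadd _ _ (h₁ n trivial) (h₂ n trivial)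
  | smul b r _ h => rw [smul_eq_mul, mul_comm, mul_smul]; exact h (b • n) trivial

include hM in
/-- **For `M` affine-localizing and `V` affine, `m` is a product section over `V` iff
`m ∈ 𝒥(V)·Γ(V, M)`** (a partition of unity on `V`). [cite: GortzWedhorn2020, Prop. 7.14 (p. 186)] -/
theorem isIdealMulSection_iff_of_isAffineOpen (m : Γ(M, V)) :
    IsIdealMulSection M J V m ↔ m ∈ J.ideal ⟨V, hV⟩ • (⊤ : Submodule Γ(X, V) Γ(M, V)) := by
  refine ⟨fun hm => ?_, isIdealMulSection_of_mem hV⟩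
  -- around each point, a basic open `D(g_x) ⊆ V_x` on which `m` is a sum of products
  have key : ∀ x ∈ V, ∃ g : Γ(X, V), x ∈ X.basicOpen g ∧ ∃ n : ℕ,
      g ^ n • m ∈ J.ideal ⟨V, hV⟩ • (⊤ : Submodule Γ(X, V) Γ(M, V)) := by
    intro x hx
    obtain ⟨W, hW, hxW, hmem⟩ := hm x hx
    obtain ⟨g, hgW, hxg⟩ := hV.exists_basicOpen_le ⟨x, hxW⟩ hx
    refine ⟨g, hxg, ?_⟩
    let D : X.affineOpens := X.affineBasicOpen (U := ⟨V, hV⟩) g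
    have hD : (D : X.Opens) = X.basicOpen g := rfl
    have hDW : (D : X.Opens) ≤ W := hgW
    have hs := map_mem_ideal_smul_top (V := W) (V' := D) hDW hmem
    have e : M.presheaf.map (homOfLE hDW).op (M.presheaf.map (homOfLE hW).op m) =
        M.presheaf.map (homOfLE (hD.trans_le (X.basicOpen_le g))).op m := by
      rw [map_map]
      exact map_eq_map M _ _ m
    rw [e] at hs
    obtain ⟨N, y, hy, hNy⟩ := exists_pow_smul_eq_map_of_mem hM hV g hD _ hs
    rw [← map_pow, ← Scheme.Modules.map_smul, ← sub_eq_zero, ← map_sub] at hNy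
    obtain ⟨k, hk⟩ := hM.torsion hV g _ (hD.trans_le (X.basicOpen_le g)) hD.ge hNy
    refine ⟨k + N, ?_⟩
    rw [smul_sub, sub_eq_zero, smul_smul, ← pow_add] at hk
    rw [← hk]
    exact Submodule.smul_mem _ _ hy
  choose g hxg n hn using key
  let s : Set Γ(X, V) := Set.range fun x : V => g x.1 x.2
  have hspan : Ideal.span s = ⊤ := by
    rw [← hV.self_le_iSup_basicOpen_iff]
    intro x hx
    exact Opens.mem_iSup.mpr ⟨⟨g x hx, ⟨x, hx⟩, rfl⟩, hxg x hx⟩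
  refine Submodule.mem_of_span_eq_top_of_smul_pow_mem _ s hspan m fun r => ?_
  obtain ⟨⟨x, hx⟩, hr⟩ := r.2
  exact ⟨n x hx, by rw [← hr]; exact hn x hx⟩

include hM in
/-- Sections of `𝒥M` over an affine `V` are exactly `𝒥(V)·Γ(V, M)`. [cite: GortzWedhorn2020, Prop. 7.14 (p. 186)] -/
theorem idealMulι_app_mem (m : Γ(idealMul M J, V)) :
    (idealMulι M J).app V m ∈ J.ideal ⟨V, hV⟩ • (⊤ : Submodule Γ(X, V) Γ(M, V)) :=
  (isIdealMulSection_iff_of_isAffineOpen hM hV _).mp (isIdealMulSection_idealMulι_app M J V m)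

include hM in
/-- **`𝒥M` is affine-localizing** for `M` affine-localizing. [folklore] -/
theorem isAffineLocalizing_idealMul : IsAffineLocalizing (idealMul M J) := by
  constructor
  · intro V hV r W hW s
    have hWaff : IsAffineOpen W := hW ▸ hV.basicOpen r
    have hs : (idealMulι M J).app W s ∈ J.ideal ⟨W, hWaff⟩ • ⊤ := idealMulι_app_mem hM hWaff s
    obtain ⟨N, y, hy, hNy⟩ := exists_pow_smul_eq_map_of_mem hM hV r (D := ⟨W, hWaff⟩) hW _ hs
    obtain ⟨y', hy'⟩ := exists_idealMulι_app_eq M J y (isIdealMulSection_of_mem hV hy)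
    refine ⟨N, y', idealMulι_app_injective M J _ ?_⟩
    rw [Scheme.Modules.Hom.app_smul]
    refine (Scheme.Modules.Hom.app_map_apply (idealMulι M J) (homOfLE (hW.trans_le (X.basicOpen_le r)))
      y').trans ?_
    rw [hy']
    exact hNy
  · intro V hV r x W hWV hrW hx
    have hx' : M.presheaf.map (homOfLE hWV).op ((idealMulι M J).app V x) = 0 := by
      rw [← Scheme.Modules.Hom.app_map_apply, hx, map_zero]
    obtain ⟨n, hn⟩ := hM.torsion hV r _ hWV hrW hx'
    refine ⟨n, idealMulι_app_injective M J _ ?_⟩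
    rw [Scheme.Modules.Hom.app_smul, hn, map_zero]

end Affine

/-- `𝒥M` is of affine-finite type if `M` is (`X` locally noetherian). [folklore] -/
theorem isAffineFiniteType_idealMul [IsLocallyNoetherian X] {M : X.Modules} (J : X.IdealSheafData)
    (hM : IsAffineFiniteType M) : IsAffineFiniteType (idealMul M J) :=
  IsAffineFiniteType.of_app_injective (idealMulι M J) (fun V _ => idealMulι_app_injective M J V) hM

/-- **`𝒥M` is coherent if `M` is** (`X` locally noetherian). [folklore] -/
theorem coh_idealMul [IsLocallyNoetherian X] {M : X.Modules} (J : X.IdealSheafData) (hM : Coh M) :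
    Coh (idealMul M J) :=
  ⟨isAffineLocalizing_idealMul hM.loc, isAffineFiniteType_idealMul J hM.ft⟩

/-! ## The quotient `M/𝒥M` -/

/-- **`M/𝒥M := coker(𝒥M → M)`.** [cite: StacksProject, Tag 01CL] -/
abbrev idealQuot : X.Modules := cokernel (idealMulι M J)

/-- The projection `M ⟶ M/𝒥M`. [folklore] -/
abbrev idealQuotπ : M ⟶ idealQuot M J := cokernel.π (idealMulι M J)

/-- `0 → 𝒥M → M → M/𝒥M → 0` is short exact. [folklore] -/
theorem shortExact_idealMul :
    (ShortComplex.mk (idealMulι M J) (idealQuotπ M J) (cokernel.condition _)).ShortExact :=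
  ShortComplex.ShortExact.mk' (ShortComplex.exact_cokernel _) inferInstance inferInstance

variable {M} in
/-- `M/𝒥M` is affine-localizing for `M` affine-localizing. [folklore] -/
theorem isAffineLocalizing_idealQuot (hM : IsAffineLocalizing M) : IsAffineLocalizing (idealQuot M J) :=
  IsAffineLocalizing.of_shortExact₃ (shortExact_idealMul M J) (isAffineLocalizing_idealMul hM) hM

variable {M} in
/-- **`M/𝒥M` is coherent if `M` is** (`X` locally noetherian). [folklore] -/
theorem coh_idealQuot [IsLocallyNoetherian X] (hM : Coh M) : Coh (idealQuot M J) :=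
  Coh.cokernel (idealMulι M J) (coh_idealMul J hM) hM

variable {M} in
/-- `M ⟶ M/𝒥M` is surjective on sections over affine opens (`M` affine-localizing). [folklore] -/
theorem idealQuotπ_app_surjective (hM : IsAffineLocalizing M) {V : X.Opens} (hV : IsAffineOpen V) :
    Function.Surjective ((idealQuotπ M J).app V) :=
  app_surjective_of_epi _ hM (isAffineLocalizing_idealQuot J hM) hV

variable {M} in
/-- **`Γ(V, M/𝒥M) = Γ(V, M)/𝒥(V)Γ(V, M)` on an affine `V`**: a section of `M` dies in `M/𝒥M` iff it
lies in `𝒥(V)·Γ(V, M)`. [cite: GortzWedhorn2020, Prop. 7.14 (p. 186)] -/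
theorem idealQuotπ_app_eq_zero_iff (hM : IsAffineLocalizing M) {V : X.Opens} (hV : IsAffineOpen V)
    (m : Γ(M, V)) :
    (idealQuotπ M J).app V m = 0 ↔ m ∈ J.ideal ⟨V, hV⟩ • (⊤ : Submodule Γ(X, V) Γ(M, V)) := by
  constructor
  · intro hm
    obtain ⟨m', rfl⟩ := (sections_exact_of_shortExact (shortExact_idealMul M J) V).2 m hm
    exact idealMulι_app_mem hM hV m'
  · intro hm
    obtain ⟨m', rfl⟩ := exists_idealMulι_app_eq M J m (isIdealMulSection_of_mem hV hm)
    exact app_app_eq_zero (ShortComplex.mk (idealMulι M J) (idealQuotπ M J) (cokernel.condition _)) V m'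

/-- The image of a product `r • m`, `r ∈ 𝒥(V)`, in `M/𝒥M` vanishes (any `M`, affine `V`). [folklore] -/
theorem idealQuotπ_app_smul_eq_zero (V : X.affineOpens) {r : Γ(X, V)} (hr : r ∈ J.ideal V)
    (m : Γ(M, V)) : (idealQuotπ M J).app V (r • m) = 0 := by
  obtain ⟨m', hm'⟩ := exists_idealMulι_app_eq M J (r • m)
    (isIdealMulSection_of_mem V.2 (Submodule.smul_mem_smul hr trivial))
  rw [← hm']
  exact app_app_eq_zero (ShortComplex.mk (idealMulι M J) (idealQuotπ M J) (cokernel.condition _)) V m'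

/-- **`𝒥·(M/𝒥M) = 0`** (any `M`). [cite: StacksProject, Tag 01CL] -/
theorem isKilledBy_idealQuot : IsKilledBy J (idealQuot M J) := by
  intro V r hr q
  refine section_eq_zero_of_locally _ _ fun x hx => ?_
  obtain ⟨W, hWV, hxW, m, hm⟩ := Scheme.Modules.exists_app_eq_of_epi (idealQuotπ M J) V q x hx
  obtain ⟨W', hW', hxW', hW'le⟩ := Opens.isBasis_iff_nbhd.mp X.isBasis_affineOpens hxW
  refine ⟨W', hW'le.trans hWV, hxW', ?_⟩
  have hle : (⟨W', hW'⟩ : X.affineOpens) ≤ V := hW'le.trans hWV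
  rw [Scheme.Modules.map_smul, map_eq_map (idealQuot M J) _ ((homOfLE hWV).op ≫ (homOfLE hW'le).op),
    ← map_map, ← hm, ← Scheme.Modules.Hom.app_map_apply, ← Scheme.Modules.Hom.app_smul]
  exact idealQuotπ_app_smul_eq_zero M J ⟨W', hW'⟩ (J.ideal_le_comap_ideal hle hr) _

/-! ## The universal property and functoriality -/

variable {M J}

/-- **A morphism to a module killed by `𝒥` kills `𝒥M`.** [cite: StacksProject, Tag 01CL] -/
theorem idealMulι_comp_eq_zero {N : X.Modules} (hN : IsKilledBy J N) (φ : M ⟶ N) :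
    idealMulι M J ≫ φ = 0 := by
  refine Scheme.Modules.hom_ext _ _ fun U => ?_
  ext s
  change φ.app U ((idealMulι M J).app U s) = 0
  refine section_eq_zero_of_locally N _ fun x hx => ?_
  obtain ⟨V, hV, hxV, hmem⟩ := isIdealMulSection_idealMulι_app M J U s x hx
  refine ⟨V, hV, hxV, ?_⟩
  rw [← Scheme.Modules.Hom.app_map_apply]
  have h := app_mem_ideal_smul_top φ V hmem
  rwa [ideal_smul_top_eq_bot_of_isKilledBy hN V, Submodule.mem_bot] at h

/-- **The universal property of `M/𝒥M`**: a morphism to a module killed by `𝒥` factors through it.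
[cite: StacksProject, Tag 01CL] -/
def idealQuotDesc {N : X.Modules} (hN : IsKilledBy J N) (φ : M ⟶ N) : idealQuot M J ⟶ N :=
  cokernel.desc _ φ (idealMulι_comp_eq_zero hN φ)

/-- The factorisation. [folklore] -/
@[reassoc (attr := simp)]
theorem idealQuotπ_desc {N : X.Modules} (hN : IsKilledBy J N) (φ : M ⟶ N) :
    idealQuotπ M J ≫ idealQuotDesc hN φ = φ :=
  cokernel.π_desc _ _ _

/-- Uniqueness: morphisms out of `M/𝒥M` agreeing on `M` are equal. [folklore] -/
theorem idealQuot_hom_ext {N : X.Modules} {f g : idealQuot M J ⟶ N}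
    (h : idealQuotπ M J ≫ f = idealQuotπ M J ≫ g) : f = g :=
  (cancel_epi (idealQuotπ M J)).mp h

variable (J)

/-- **`φ/𝒥 : M/𝒥M ⟶ N/𝒥N`** induced by `φ : M ⟶ N`. [cite: StacksProject, Tag 01CL] -/
def idealQuotMap {M N : X.Modules} (φ : M ⟶ N) : idealQuot M J ⟶ idealQuot N J :=
  idealQuotDesc (isKilledBy_idealQuot N J) (φ ≫ idealQuotπ N J)

/-- **Naturality of `M ⟶ M/𝒥M`.** [folklore] -/
@[reassoc (attr := simp)]
theorem idealQuotπ_idealQuotMap {M N : X.Modules} (φ : M ⟶ N) :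
    idealQuotπ M J ≫ idealQuotMap J φ = φ ≫ idealQuotπ N J :=
  idealQuotπ_desc _ _

/-- `𝟙/𝒥 = 𝟙`. [folklore] -/
@[simp]
theorem idealQuotMap_id (M : X.Modules) : idealQuotMap J (𝟙 M) = 𝟙 _ :=
  idealQuot_hom_ext (by rw [idealQuotπ_idealQuotMap, Category.id_comp, Category.comp_id])

/-- `(φ ≫ ψ)/𝒥 = φ/𝒥 ≫ ψ/𝒥`. [folklore] -/
@[reassoc]
theorem idealQuotMap_comp {M N P : X.Modules} (φ : M ⟶ N) (ψ : N ⟶ P) :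
    idealQuotMap J (φ ≫ ψ) = idealQuotMap J φ ≫ idealQuotMap J ψ :=
  idealQuot_hom_ext (by
    rw [idealQuotπ_idealQuotMap, idealQuotπ_idealQuotMap_assoc, Category.assoc,
      idealQuotπ_idealQuotMap])

/-- `0/𝒥 = 0`. [folklore] -/
@[simp]
theorem idealQuotMap_zero (M N : X.Modules) : idealQuotMap J (0 : M ⟶ N) = 0 :=
  idealQuot_hom_ext (by rw [idealQuotπ_idealQuotMap, zero_comp, comp_zero])

/-- **`(− /𝒥)` preserves epimorphisms.** [folklore] -/
theorem epi_idealQuotMap {M N : X.Modules} (φ : M ⟶ N) [Epi φ] : Epi (idealQuotMap J φ) :=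
  epi_of_epi_fac (idealQuotπ_idealQuotMap J φ)

/-- **`(− /𝒥)` commutes with multiplication by a global function.** [folklore] -/
theorem idealQuotMap_globalScalar (M : X.Modules) (a : Γ(X, ⊤)) :
    idealQuotMap J (globalScalar M a) = globalScalar (idealQuot M J) a :=
  idealQuot_hom_ext (by rw [idealQuotπ_idealQuotMap, globalScalar_comp])

/-- **The functor `M ↦ M/𝒥M`.** [cite: StacksProject, Tag 01CL] -/
def idealQuotFunctor : X.Modules ⥤ X.Modules where
  obj M := idealQuot M J
  map φ := idealQuotMap J φ
  map_id M := idealQuotMap_id J M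
  map_comp φ ψ := idealQuotMap_comp J φ ψ

/-- `idealQuotFunctor` on objects. [folklore] -/
@[simp]
theorem idealQuotFunctor_obj (M : X.Modules) : (idealQuotFunctor J).obj M = idealQuot M J := rfl

/-- `idealQuotFunctor` on morphisms. [folklore] -/
@[simp]
theorem idealQuotFunctor_map {M N : X.Modules} (φ : M ⟶ N) :
    (idealQuotFunctor J).map φ = idealQuotMap J φ := rfl

/-- The natural transformation `𝟭 ⟶ (− /𝒥)`. [folklore] -/
def idealQuotπNatTrans : 𝟭 X.Modules ⟶ idealQuotFunctor J where
  app M := idealQuotπ M J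
  naturality _ _ φ := (idealQuotπ_idealQuotMap J φ).symm

/-- **If `𝒥` kills `M` then `M ⟶ M/𝒥M` is an isomorphism** (`𝒥M = 0`: a product section is locally
in `𝒥(V)·Γ(V, M) = 0`). [folklore] -/
theorem isIso_idealQuotπ_of_isKilledBy {M : X.Modules} (hM : IsKilledBy J M) : IsIso (idealQuotπ M J) := by
  have h0 : idealMulι M J = 0 := by
    rw [← Category.comp_id (idealMulι M J)]
    exact idealMulι_comp_eq_zero hM (𝟙 M)
  haveI : Mono (idealQuotπ M J) := (shortExact_idealMul M J).exact.mono_g h0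
  exact isIso_of_mono_of_epi _

/-! ## Right exactness: `(coker w)/𝒥 ≅ coker (w/𝒥)` -/

section Cokernel

variable {P M : X.Modules} (w : P ⟶ M)

/-- The comparison `coker(w/𝒥) ⟶ (coker w)/𝒥`. [folklore] -/
def idealQuotCokernelHom : cokernel (idealQuotMap J w) ⟶ idealQuot (cokernel w) J :=
  cokernel.desc _ (idealQuotMap J (cokernel.π w)) (by
    rw [← idealQuotMap_comp, cokernel.condition, idealQuotMap_zero])

/-- `w ≫ π_M ≫ coker.π (w/𝒥) = 0`. [folklore] -/
theorem comp_idealQuotπ_cokernel_π :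
    w ≫ idealQuotπ M J ≫ cokernel.π (idealQuotMap J w) = 0 := by
  rw [← Category.assoc, ← idealQuotπ_idealQuotMap, Category.assoc, cokernel.condition, comp_zero]

/-- Its inverse `(coker w)/𝒥 ⟶ coker(w/𝒥)` (`coker(w/𝒥)` is killed by `𝒥`). [folklore] -/
def idealQuotCokernelInv : idealQuot (cokernel w) J ⟶ cokernel (idealQuotMap J w) :=
  idealQuotDesc (IsKilledBy.of_epi (cokernel.π _) (isKilledBy_idealQuot M J))
    (cokernel.desc w (idealQuotπ M J ≫ cokernel.π (idealQuotMap J w)) (comp_idealQuotπ_cokernel_π J w))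

/-- `coker.π (w/𝒥) ≫ hom = (coker.π w)/𝒥`. [folklore] -/
@[reassoc (attr := simp)]
theorem cokernel_π_idealQuotCokernelHom :
    cokernel.π (idealQuotMap J w) ≫ idealQuotCokernelHom J w = idealQuotMap J (cokernel.π w) :=
  cokernel.π_desc _ _ _

/-- `π_{coker w} ≫ inv = coker.desc w (π_M ≫ coker.π (w/𝒥))`. [folklore] -/
@[reassoc (attr := simp)]
theorem idealQuotπ_idealQuotCokernelInv :
    idealQuotπ (cokernel w) J ≫ idealQuotCokernelInv J w =
      cokernel.desc w (idealQuotπ M J ≫ cokernel.π (idealQuotMap J w)) (comp_idealQuotπ_cokernel_π J w) :=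
  idealQuotπ_desc _ _

/-- **`(− /𝒥)` is right exact: `coker(w/𝒥) ≅ (coker w)/𝒥`.** [cite: StacksProject, Tag 01CL] -/
def idealQuotCokernelIso : cokernel (idealQuotMap J w) ≅ idealQuot (cokernel w) J where
  hom := idealQuotCokernelHom J w
  inv := idealQuotCokernelInv J w
  hom_inv_id := by
    haveI : Epi (idealQuotπ M J ≫ cokernel.π (idealQuotMap J w)) := epi_comp _ _
    rw [← cancel_epi (idealQuotπ M J ≫ cokernel.π (idealQuotMap J w)), Category.assoc,
      cokernel_π_idealQuotCokernelHom_assoc, idealQuotπ_idealQuotMap_assoc, idealQuotπ_idealQuotCokernelInv,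
      cokernel.π_desc, Category.comp_id]
  inv_hom_id := by
    haveI : Epi (cokernel.π w ≫ idealQuotπ (cokernel w) J) := epi_comp _ _
    rw [← cancel_epi (cokernel.π w ≫ idealQuotπ (cokernel w) J), Category.assoc,
      idealQuotπ_idealQuotCokernelInv_assoc, cokernel.π_desc_assoc, Category.assoc,
      cokernel_π_idealQuotCokernelHom, idealQuotπ_idealQuotMap, Category.comp_id]

/-- Compatibility of the isomorphism with the two projections from `M`:
`π_M ≫ coker.π(w/𝒥) ≫ ≅ = coker.π w ≫ π_{coker w}`. [folklore] -/
@[reassoc]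
theorem idealQuotπ_cokernel_π_idealQuotCokernelIso_hom :
    idealQuotπ M J ≫ cokernel.π (idealQuotMap J w) ≫ (idealQuotCokernelIso J w).hom =
      cokernel.π w ≫ idealQuotπ (cokernel w) J := by
  change idealQuotπ M J ≫ cokernel.π _ ≫ idealQuotCokernelHom J w = _
  rw [cokernel_π_idealQuotCokernelHom, idealQuotπ_idealQuotMap]

end Cokernel

end Literature.AlgebraicGeometry.Modules

end
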